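import Summits.QuantumFields.YangMills.Theorems.LangevinControlUVOSLegsFromFemtoAndGapDefs
import HarnessLib

/-!
# Route `ForcedResponseSkewness`, crux `RunningCouplingCeiling` (stmt-QuantumFields-23617): vocabulary of line
# `pointwise-log-ceiling`

Route-posited objects (D-0016 `<Route><Crux>Defs` file) shared by the registered stubs of the skeleton
`Cruxes/RunningCouplingCeiling/Lines/pointwise_log_ceiling.lean` (lead `ym-line-frs-p1`): VERBATIM the skeleton's declarations
(same namespace `Summit.QuantumFields.YangMills.Cruxes.RunningCouplingCeiling.Pointwise`, so the registered signatures
`stub_pointwise : PointwiseSig`, `stub_smear : SmearSig`, `stub_tails : TailsSig` are unchanged and stub files import this module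
instead of re-declaring).  NOTHING here is asserted: `torusDist`, `torusCov`, `KernelBounds` are bookkeeping over tree objects
(`Q2_eq_sum_torusCov` is `rfl`), and every `def … : Prop` is a line statement some registered stub proves.

* `torusDist`, `torusCov`, `Q2_eq_sum_torusCov`, `KernelBounds` — torus distance on `box L`, the covariance kernel of `Q2`, the
  three pointwise kernel bounds (bounded / scale-free `d⁸|K| ≤ C₁` / running-coupling `d⁸|K| ≤ C₀/log²(1/(t d))` below the unit).
* `PointwiseSig` (physics, XL: floor ⇒ pointwise ceilings; contains the route card's FloorPinsUnit + LogCeilingAtPhysicalScale),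
  `SmearSig` (analysis, provable now: smeared ceiling from kernel bounds for time-bounded `tsupport v`),
  `TailsSig` (GUARD, not to be staffed: the crux body for `v` with time-UNBOUNDED support — LEAD'S CAVEAT: believed false whenever
  its floor hypothesis holds, by periodic wrap-around of the Schwartz tails of `θv`, `v` on the minimal admissible torus and the
  non-integrable `d⁻⁸` short-distance singularity of the dimension-4 density; isolated only to make the `∀ Schwartz v` typing of
  the crux visible; disappears when the crux is restated with `HasCompactSupport v`; see
  `Cruxes/RunningCouplingCeiling/Lines/pointwise-log-ceiling.md`).

Route rev 3 (crux repaired as stmt-QuantumFields-24275, compact supports, uniform constant): `PointwiseSigR`, `SmearUniformSig`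
  are the statements of the successor line «pointwise-log-ceiling-r» (same vocabulary; no tail guard).

No summit is proved by any of this (leaf R2a `BalabanLadder.NT`, conditional line; the YM mass gap is NOT proved).
Refs: route file `Theses/ForcedResponseSkewness.lean`; line card `Cruxes/RunningCouplingCeiling/Lines/pointwise-log-ceiling.md`;
Bałaban CMP 122 (1989); Montvay–Münster (1994) §3.4 (running coupling).
-/

set_option autoImplicit false

noncomputable section

namespace Summit.QuantumFields.YangMills.Cruxes.RunningCouplingCeiling.Pointwise

open scoped SchwartzMap
open MeasureTheory Filter Topology
open Literature.MathematicalPhysics.QuantumFieldTheory Literature.MathematicalPhysics.QuantumLattice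
open Literature.Probability.LatticeModels
open Summit.QuantumFields.YangMills.Cruxes.OSLegsFromFemtoAndGap.DlrCollarTransfer

/-! ## Vocabulary (bookkeeping over tree objects; nothing posited) -/

/-- Euclidean torus distance of two sites of `box 4 L` read on the torus `(ℤ/(2L+1)ℤ)⁴` (as in the femto
two-point package `TwoPoint`: `√Σ_k valMinAbs(x_k − y_k)²`). -/
def torusDist (L : ℕ) (x y : Fin 4 → ℤ) : ℝ :=
  Real.sqrt (∑ k : Fin 4, ((((x k - y k : ℤ) : ZMod (2 * L + 1)).valMinAbs : ℤ) : ℝ) ^ 2)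

section Cov

variable (G : Type) [Group G] [TopologicalSpace G] [IsTopologicalGroup G] [CompactSpace G]
  [MeasurableSpace G] [BorelSpace G] (r : LatticeRep G)

/-- Torus covariance of the action densities at `x, y` (the kernel of `Q2`:
`Q2_{β,L,s}(f,g) = Σ_{x,y ∈ box L} f(s x) g(s y) · torusCov β L x y`, see `Q2_eq_sum_torusCov`). -/
def torusCov (β : ℝ) (L : ℕ) (x y : Fin 4 → ℤ) : ℝ :=
  torusE G r β L (fun U => dens G r x U * dens G r y U) - torusE G r β L (dens G r x) * torusE G r β L (dens G r y)

/-- `Q2` is the `θv ⊗ v`-smearing of `torusCov` (definitional). -/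
theorem Q2_eq_sum_torusCov (β : ℝ) (L : ℕ) (s : ℝ) (f g : 𝓢(EuclideanSpace ℝ (Fin 4), ℝ)) :
    Q2 G r β L s f g = ∑ x ∈ box 4 L, ∑ y ∈ box 4 L, f (s • siteToE x) * g (s • siteToE y) * torusCov G r β L x y :=
  rfl

end Cov

/-- The three pointwise kernel bounds at unit `t` on the torus of half-side `L`: bounded (`C₂`), scale-free
(`d⁸|K| ≤ C₁` beyond `n₀`), and running-coupling decay below the unit (`d⁸|K| ≤ C₀/log²(1/(t d))` for
`n₀ ≤ d`, `t d ≤ 1/2`), `d` = torus distance. -/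
def KernelBounds (C₀ C₁ C₂ : ℝ) (n₀ : ℕ) (t : ℝ) (L : ℕ) (K : (Fin 4 → ℤ) → (Fin 4 → ℤ) → ℝ) : Prop :=
  ∀ x ∈ box 4 L, ∀ y ∈ box 4 L,
    |K x y| ≤ C₂ ∧
    ((n₀ : ℝ) ≤ torusDist L x y → torusDist L x y ^ 8 * |K x y| ≤ C₁) ∧
    ((n₀ : ℝ) ≤ torusDist L x y → t * torusDist L x y ≤ 1 / 2 →
      torusDist L x y ^ 8 * |K x y| ≤ C₀ / Real.log (1 / (t * torusDist L x y)) ^ 2)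

/-! ## The registered stub statements -/

/-- **Statement of `stub_pointwise`** (PHYSICS, XL; contains the route's layer-2 pair FloorPinsUnit +
LogCeilingAtPhysicalScale): for every compact simple `G`, `r`, unit map `a → 0⁺` and positive-time `v` carrying a
clause-(i) floor, the torus covariance of the action densities obeys `KernelBounds C₀ C₁ C₂ n₀ (a β) L` for all
large `β` and all tori `a(β)·L ≥ Λ₀`.  (Why it might fail: the log clause at `d ~ ξ_lat ≪ 1/(2a(β))` is false for a
unit drifting COARSER than the correlation length — excluded only by «floor ⇒ unit ≲ K·ξ», a clustering/gap-class
input; the decay itself is Bałaban running-coupling stability for correlators, not in print.) -/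
def PointwiseSig : Prop :=
  ∀ (G : Type) [Group G] [TopologicalSpace G] [IsTopologicalGroup G] [CompactSpace G],
    IsCompactSimpleLieGroup G →
    letI : MeasurableSpace G := borel G
    haveI : BorelSpace G := ⟨rfl⟩
    ∀ (r : LatticeRep G) (a : ℝ → ℝ) (v : 𝓢(EuclideanSpace ℝ (Fin 4), ℝ)),
      (∀ β, 0 < a β) → Filter.Tendsto a Filter.atTop (nhds 0) →
      tsupport v ⊆ {y : EuclideanSpace ℝ (Fin 4) | 0 < y 0} →
      (∃ ε β₅ Λ₅ : ℝ, 0 < ε ∧ ∀ β : ℝ, β₅ ≤ β → ∀ L : ℕ, Λ₅ ≤ a β * L →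
        ε ≤ Q2 G r β L (a β) (thetaTest 4 v) v) →
      ∃ C₀ C₁ C₂ : ℝ, ∃ n₀ : ℕ, ∃ β₀ Λ₀ : ℝ, ∀ β : ℝ, β₀ ≤ β → ∀ L : ℕ, Λ₀ ≤ a β * L →
        KernelBounds C₀ C₁ C₂ n₀ (a β) L (torusCov G r β L)

/-- **Statement of `stub_smear`** (ANALYSIS, L, provable now): the smeared ceiling from pointwise kernel bounds, for
a Schwartz `v` supported in positive time AND time-bounded.  Quantifier order as in the crux: `C` before `Λ`,
then a smallness threshold `t₀` for the unit and a torus threshold `Λ₆` (choose `Λ₆ > 2T` so that no pair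
`(θv(s x) ≠ 0, v(s y) ≠ 0)` wraps around the periodic time direction). -/
def SmearSig : Prop :=
  ∀ (v : 𝓢(EuclideanSpace ℝ (Fin 4), ℝ)) (T : ℝ),
    tsupport v ⊆ {y : EuclideanSpace ℝ (Fin 4) | 0 < y 0} →
    tsupport v ⊆ {y : EuclideanSpace ℝ (Fin 4) | y 0 ≤ T} →
    ∀ (C₀ C₁ C₂ : ℝ) (n₀ : ℕ), ∃ C : ℝ, ∀ Λ : ℝ, 2 ≤ Λ → ∃ t₀ Λ₆ : ℝ, 0 < t₀ ∧
      ∀ t : ℝ, 0 < t → t ≤ t₀ → ∀ L : ℕ, Λ₆ ≤ t * L →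
        ∀ K : (Fin 4 → ℤ) → (Fin 4 → ℤ) → ℝ, KernelBounds C₀ C₁ C₂ n₀ t L K →
          ∀ l : ℝ, l ∈ Set.Icc Λ (2 * Λ) →
            ∑ x ∈ box 4 L, ∑ y ∈ box 4 L,
              (thetaTest 4 v) ((l * t) • siteToE x) * v ((l * t) • siteToE y) * K x y ≤ C / Real.log Λ ^ 2

/-- **Statement of `stub_tails`** (GUARD — DO NOT STAFF): the crux body for `v` whose support is NOT bounded in time.
Believed false whenever its floor hypothesis holds (periodic wrap-around of the Schwartz tails of `θv`, `v` on
the minimal admissible torus × the non-integrable `d⁻⁸` short-distance singularity of the dimension-4 density ⇒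
`Q2 → +∞` along `a(β)·L ≈ Λ₆`); it is registered only to isolate the mis-typing of the crux (`∀ v` Schwartz),
and vanishes when the crux is restated with `HasCompactSupport v`. -/
def TailsSig : Prop :=
  ∀ (G : Type) [Group G] [TopologicalSpace G] [IsTopologicalGroup G] [CompactSpace G],
    IsCompactSimpleLieGroup G →
    letI : MeasurableSpace G := borel G
    haveI : BorelSpace G := ⟨rfl⟩
    ∀ (r : LatticeRep G) (a : ℝ → ℝ) (v : 𝓢(EuclideanSpace ℝ (Fin 4), ℝ)),
      (∀ β, 0 < a β) → Filter.Tendsto a Filter.atTop (nhds 0) →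
      tsupport v ⊆ {y : EuclideanSpace ℝ (Fin 4) | 0 < y 0} →
      (∃ ε β₅ Λ₅ : ℝ, 0 < ε ∧ ∀ β : ℝ, β₅ ≤ β → ∀ L : ℕ, Λ₅ ≤ a β * L →
        ε ≤ Q2 G r β L (a β) (thetaTest 4 v) v) →
      (¬ ∃ T : ℝ, tsupport v ⊆ {y : EuclideanSpace ℝ (Fin 4) | y 0 ≤ T}) →
      ∃ C : ℝ, ∀ Λ : ℝ, 2 ≤ Λ → ∃ β₆ Λ₆ : ℝ, ∀ β : ℝ, β₆ ≤ β → ∀ L : ℕ, Λ₆ ≤ a β * L →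
        ∀ l : ℝ, l ∈ Set.Icc Λ (2 * Λ) → Q2 G r β L (l * a β) (thetaTest 4 v) v ≤ C / Real.log Λ ^ 2


/-! ## Route rev 3 (repaired crux, stmt-QuantumFields-24275): line «pointwise-log-ceiling-r»

The repaired `RunningCouplingCeiling` asks for ONE constant uniform over the L¹-normalised sources supported in a fixed
positive-time ball `closedBall p ρ₀` (`ρ₀ < p₀`), the unit being pinned by a compactly supported floor witness.  The cut is
the same (pointwise kernel bounds + smearing); the guard `TailsSig` is no longer needed (compact supports). -/

/-- **Statement of `stub_pointwise` of line «pointwise-log-ceiling-r»** (PHYSICS, XL): the repaired pinning hypothesis (a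
compactly supported positive-time clause-(i) floor witness) ⇒ the pointwise kernel bounds `KernelBounds C₀ C₁ C₂ n₀ (a β) L`
for the torus covariance of the action densities, for all large `β` and tori `a(β)·L ≥ Λ₀` — constants independent of any
source (contains the route card's FloorPinsUnit + LogCeilingAtPhysicalScale; Bałaban-class, not in print). -/
def PointwiseSigR : Prop :=
  ∀ (G : Type) [Group G] [TopologicalSpace G] [IsTopologicalGroup G] [CompactSpace G],
    IsCompactSimpleLieGroup G →
    letI : MeasurableSpace G := borel G
    haveI : BorelSpace G := ⟨rfl⟩
    ∀ (r : LatticeRep G) (a : ℝ → ℝ), (∀ β, 0 < a β) → Filter.Tendsto a Filter.atTop (nhds 0) →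
      (∃ (v₀ : 𝓢(EuclideanSpace ℝ (Fin 4), ℝ)) (ε β₅ Λ₅ : ℝ), HasCompactSupport v₀ ∧
        tsupport v₀ ⊆ {y : EuclideanSpace ℝ (Fin 4) | 0 < y 0} ∧ 0 < ε ∧
        ∀ β : ℝ, β₅ ≤ β → ∀ L : ℕ, Λ₅ ≤ a β * L → ε ≤ Q2 G r β L (a β) (thetaTest 4 v₀) v₀) →
      ∃ C₀ C₁ C₂ : ℝ, ∃ n₀ : ℕ, ∃ β₀ Λ₀ : ℝ, ∀ β : ℝ, β₀ ≤ β → ∀ L : ℕ, Λ₀ ≤ a β * L →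
        KernelBounds C₀ C₁ C₂ n₀ (a β) L (torusCov G r β L)

/-- **Statement of `stub_smearUniform` of line «pointwise-log-ceiling-r»** (ANALYSIS, provable now): the smeared ceiling
with ONE constant `C = C(C₀, C₁, n₀, p, ρ₀)` for all L¹-normalised sources in the positive-time ball `closedBall p ρ₀`
(`ρ₀ < p₀`): the supports of `θv` and `v` are `2(p₀ − ρ₀)`-separated in time and bounded by `‖p‖ + ρ₀`, so no wall
flatness is needed; the smallness threshold `t₀` and the torus threshold `Λ₆` may depend on the source (Riemann sums
`s⁴ Σ |v(s x)| ≤ 2` for small mesh), exactly as the crux allows. -/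
def SmearUniformSig : Prop :=
  ∀ (p : EuclideanSpace ℝ (Fin 4)) (ρ₀ : ℝ), 0 < ρ₀ → ρ₀ < p 0 →
    ∀ (C₀ C₁ C₂ : ℝ) (n₀ : ℕ), ∃ C : ℝ, ∀ v : 𝓢(EuclideanSpace ℝ (Fin 4), ℝ),
      tsupport v ⊆ Metric.closedBall p ρ₀ → (∫ y, |v y|) ≤ 1 →
      ∀ Λ : ℝ, 2 ≤ Λ → ∃ t₀ Λ₆ : ℝ, 0 < t₀ ∧
        ∀ t : ℝ, 0 < t → t ≤ t₀ → ∀ L : ℕ, Λ₆ ≤ t * L →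
          ∀ K : (Fin 4 → ℤ) → (Fin 4 → ℤ) → ℝ, KernelBounds C₀ C₁ C₂ n₀ t L K →
            ∀ l : ℝ, l ∈ Set.Icc Λ (2 * Λ) →
              ∑ x ∈ box 4 L, ∑ y ∈ box 4 L,
                (thetaTest 4 v) ((l * t) • siteToE x) * v ((l * t) • siteToE y) * K x y ≤ C / Real.log Λ ^ 2


/-! ## Route rev 3, line «pointwise-log-ceiling-r» RESHAPED (lead ym-line-frs-p1 g2, 2026-08-28): the LOCAL split

The composition only needs LOCAL kernel bounds (width prover frs-p3: `runningCouplingCeiling_of_localKernelBounds`,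
`…RunningCouplingCeilingOfKernelBounds`), so the single physics stub `stub_pointwise : PointwiseSigR` — whose GLOBAL
scale-free clause (`d⁸|Cov| ≤ C₁` at ALL torus distances, all tori) is IR/clustering-class content the crux never uses —
is replaced by TWO stubs of different provenance: `stub_scaleFreeLocal : ScaleFreeLocalSigR` (hyperscaling boundedness
`d⁸|Cov| ≤ C₁(ℓ)` at physical separation `≤ ℓ`, for every `ℓ`; E0′/FBL-class — it is LITERALLY the conclusion of
`localScaleFree_of_momentBounds6` (p593932), i.e. follows from the spine's UV input `MomentBounds6 G r a`; no pinning
needed) and `stub_logCeiling : LogCeilingSigR` (running-coupling decay `d⁸|Cov| ≤ C₀/log²(1/(a(β)d))` below half the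
unit, given the pinning floor witness; asymptotic-freedom class, not in print as a theorem).  Nothing here is asserted. -/

/-- **Statement of `stub_scaleFreeLocal` of line «pointwise-log-ceiling-r» (reshaped)** (E0′/FBL-class): for every
compact simple `G`, `r`, unit map `a → 0⁺` and physical radius `ℓ > 0`, constants `C₁ n₀ β₀` with
`d⁸ |torusCov β L x y| ≤ C₁` for all `β ≥ β₀`, all odd tori, all sites at torus distance `d ≥ n₀` with `a(β)·d ≤ ℓ`
(verbatim the conclusion of `localScaleFree_of_momentBounds6`: discharged by `MomentBounds6 G r a`). -/
def ScaleFreeLocalSigR : Prop :=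
  ∀ (G : Type) [Group G] [TopologicalSpace G] [IsTopologicalGroup G] [CompactSpace G],
    IsCompactSimpleLieGroup G →
    letI : MeasurableSpace G := borel G
    haveI : BorelSpace G := ⟨rfl⟩
    ∀ (r : LatticeRep G) (a : ℝ → ℝ), (∀ β, 0 < a β) → Filter.Tendsto a Filter.atTop (nhds 0) →
      ∀ ℓ : ℝ, 0 < ℓ → ∃ C₁ : ℝ, ∃ n₀ : ℕ, ∃ β₀ : ℝ, ∀ β : ℝ, β₀ ≤ β → ∀ (L : ℕ) (x y : Fin 4 → ℤ),
        (n₀ : ℝ) ≤ torusDist L x y → a β * torusDist L x y ≤ ℓ →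
          torusDist L x y ^ 8 * |torusCov G r β L x y| ≤ C₁

/-- **Statement of `stub_logCeiling` of line «pointwise-log-ceiling-r» (reshaped)** (ASYMPTOTIC-FREEDOM class, XL,
the line's genuine physics debt): for every compact simple `G`, `r`, unit map `a → 0⁺` PINNED by a compactly supported
positive-time clause-(i) floor witness, constants `C₀ n₀ β₀ Λ₀` with the running-coupling ceiling
`d⁸ |torusCov β L x y| ≤ C₀ / log²(1/(a(β)·d))` for `β ≥ β₀`, tori `a(β)·L ≥ Λ₀`, sites of `box L` at torus distance
`n₀ ≤ d` and physical separation `a(β)·d ≤ 1/2` (RG-improved one-loop AF for the dens–dens covariance at physical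
separation below the unit; the pinning excludes units drifting coarser than the correlation length, for which the
clause fails at `d ~ ξ_lat`; Bałaban-class, not in print). -/
def LogCeilingSigR : Prop :=
  ∀ (G : Type) [Group G] [TopologicalSpace G] [IsTopologicalGroup G] [CompactSpace G],
    IsCompactSimpleLieGroup G →
    letI : MeasurableSpace G := borel G
    haveI : BorelSpace G := ⟨rfl⟩
    ∀ (r : LatticeRep G) (a : ℝ → ℝ), (∀ β, 0 < a β) → Filter.Tendsto a Filter.atTop (nhds 0) →
      (∃ (v₀ : 𝓢(EuclideanSpace ℝ (Fin 4), ℝ)) (ε β₅ Λ₅ : ℝ), HasCompactSupport v₀ ∧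
        tsupport v₀ ⊆ {y : EuclideanSpace ℝ (Fin 4) | 0 < y 0} ∧ 0 < ε ∧
        ∀ β : ℝ, β₅ ≤ β → ∀ L : ℕ, Λ₅ ≤ a β * L → ε ≤ Q2 G r β L (a β) (thetaTest 4 v₀) v₀) →
      ∃ C₀ : ℝ, ∃ n₀ : ℕ, ∃ β₀ Λ₀ : ℝ, ∀ β : ℝ, β₀ ≤ β → ∀ L : ℕ, Λ₀ ≤ a β * L →
        ∀ x ∈ box 4 L, ∀ y ∈ box 4 L,
          (n₀ : ℝ) ≤ torusDist L x y → a β * torusDist L x y ≤ 1 / 2 →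
            torusDist L x y ^ 8 * |torusCov G r β L x y| ≤ C₀ / Real.log (1 / (a β * torusDist L x y)) ^ 2

/-- **Statement of `stub_scaleFreeLocal` of line «pointwise-log-ceiling-r» (reshaped, PINNED form — supersedes
`ScaleFreeLocalSigR` as the registered signature; width prover frs-p3's typing caveat 02:36Z)**: the same local
scale-free bound, but for unit maps PINNED by a compactly supported positive-time clause-(i) floor witness (the
hypothesis block of `LogCeilingSigR`/`PointwiseSigR`).  Without the pinning the statement would quantify over units
drifting FINER than the correlation length, for which `a(β)·d ≤ ℓ` reaches physical separations ≫ ξ and the bound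
`d⁸|Cov| ≤ C₁` is power-law CLUSTERING (IR-class); with it, the stub is `MomentBounds6 G r a` in THIS unit
(`localScaleFree_of_momentBounds6`) = the spine's `MomentBounds6` in the record unit ∧ «floor ⇒ unit not finer than
the record unit» (FloorPinsUnit, fine side — the one interface fact this route's free unit map `a` costs). -/
def ScaleFreeLocalPinnedSigR : Prop :=
  ∀ (G : Type) [Group G] [TopologicalSpace G] [IsTopologicalGroup G] [CompactSpace G],
    IsCompactSimpleLieGroup G →
    letI : MeasurableSpace G := borel G
    haveI : BorelSpace G := ⟨rfl⟩
    ∀ (r : LatticeRep G) (a : ℝ → ℝ), (∀ β, 0 < a β) → Filter.Tendsto a Filter.atTop (nhds 0) →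
      (∃ (v₀ : 𝓢(EuclideanSpace ℝ (Fin 4), ℝ)) (ε β₅ Λ₅ : ℝ), HasCompactSupport v₀ ∧
        tsupport v₀ ⊆ {y : EuclideanSpace ℝ (Fin 4) | 0 < y 0} ∧ 0 < ε ∧
        ∀ β : ℝ, β₅ ≤ β → ∀ L : ℕ, Λ₅ ≤ a β * L → ε ≤ Q2 G r β L (a β) (thetaTest 4 v₀) v₀) →
      ∀ ℓ : ℝ, 0 < ℓ → ∃ C₁ : ℝ, ∃ n₀ : ℕ, ∃ β₀ : ℝ, ∀ β : ℝ, β₀ ≤ β → ∀ (L : ℕ) (x y : Fin 4 → ℤ),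
        (n₀ : ℝ) ≤ torusDist L x y → a β * torusDist L x y ≤ ℓ →
          torusDist L x y ^ 8 * |torusCov G r β L x y| ≤ C₁

/-- The unpinned form trivially gives the pinned one (the registered stub is the weaker, pinned statement). -/
theorem scaleFreeLocalPinnedSigR_of_scaleFreeLocalSigR (h : ScaleFreeLocalSigR) : ScaleFreeLocalPinnedSigR :=
  fun G _ _ _ _ hG r a ha hlim _ => h G hG r a ha hlim


/-! ## Line «pointwise-log-ceiling-r» v4 (lead ym-line-frs-p1 g4 adopting width seat frs-p3 g5's femto reshape, 2026-08-28):
the AF debt of crux 24275 in the spine's FEMTO currency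

`stub_logCeiling : LogCeilingSigR` (torus level) is REDUCED by frs-p3's `logCeilingSigR_of_fbl6_femtoLog` /
`runningCouplingCeiling_of_fbl6_femtoLog` (p610011; via p607250/p607517 and the lead's p607908) to the route's shared engine stub
`FBL6PinnedSigR` and ONE femto asymptotic-freedom statement, the FEMTO LOG TWO-POINT LAW below — the UPPER clause of the record's
`FC2` with the asymptotic-freedom shape `Γ(s) = 1/log²(1/s)` and the record's scale-indexed collar depth `K(s)` (`K ≥ 1`,
`s·K(s) → 0`).  Model check (RG one loop with a worst-case flux background `𝔅 ≍ Φ/depth²` and RUNNING coefficients): the vacuum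
part is `≍ ḡ⁴(s) ≍ 1/(2b₀ log(1/s))²`; the background contaminates `‖y−x‖⁸·kerCov` by `≍ Φ²ḡ²(s)‖y−x‖⁴/depth⁴ ≤ Φ²ḡ²(s)/K(s)⁴`,
which is `≤ C₂ḡ⁴(s)` once `K(s) ≍ (Φ² log(1/s))^{1/4}` — allowed (`s·K(s) → 0`); image terms are smaller by further powers of
`1/K`.  So, unlike an absolutely-summable near-pair law, this SUP law passes the flux-background audit (frs-p3 06:37Z; the g3 note
«stub_logCeiling not femto-isable» is withdrawn).  Engine: Bałaban small-field RG in a femto cube with arbitrary exterior,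
two-point function of the action density with logarithmic precision — not in print.  Nothing here is asserted. -/

/-- **Statement of `stub_femtoLog` of line «pointwise-log-ceiling-r» v4** (ASYMPTOTIC-FREEDOM class, femto currency; text =
frs-p3's `hLog` binder of `runningCouplingCeiling_of_fbl6_femtoLog`, verbatim): along a unit pinned by a compactly supported
positive-time clause-(i) floor witness, the femto log two-point law — on every femto cube (`b·a(β) ≤ ℓ₂`), for EVERY exterior,
pairs with `n₀ ≤ ‖y−x‖` at collar depth `K(‖y−x‖·a(β))·‖y−x‖ ≤ depth x, depth y` satisfy
`‖y−x‖⁸ |kerCov_η(dens x, dens y)| ≤ C₂ / log²(1/(‖y−x‖·a(β)))`, with `K ≥ 1` and `s·K(s) → 0` as `s → 0⁺`. -/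
def FemtoLogSigR : Prop :=
  ∀ (G : Type) [Group G] [TopologicalSpace G] [IsTopologicalGroup G] [CompactSpace G],
    IsCompactSimpleLieGroup G →
    letI : MeasurableSpace G := borel G
    haveI : BorelSpace G := ⟨rfl⟩
    ∀ (r : LatticeRep G) (a : ℝ → ℝ), (∀ β, 0 < a β) → Filter.Tendsto a Filter.atTop (nhds 0) →
      (∃ (v₀ : 𝓢(EuclideanSpace ℝ (Fin 4), ℝ)) (ε β₅ Λ₅ : ℝ), HasCompactSupport v₀ ∧
        tsupport v₀ ⊆ {y : EuclideanSpace ℝ (Fin 4) | 0 < y 0} ∧ 0 < ε ∧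
        ∀ β : ℝ, β₅ ≤ β → ∀ L : ℕ, Λ₅ ≤ a β * L → ε ≤ Q2 G r β L (a β) (thetaTest 4 v₀) v₀) →
      ∃ (ℓ₂ C₂ β₂ : ℝ) (K : ℝ → ℝ) (n₀ : ℕ), 0 < ℓ₂ ∧ (∀ s, 1 ≤ K s) ∧
        Filter.Tendsto (fun s : ℝ => s * K s) (nhdsWithin 0 (Set.Ioi 0)) (nhds 0) ∧
        ∀ β : ℝ, β₂ ≤ β → ∀ (c : Fin 4 → ℤ) (b : ℕ), (b : ℝ) * a β ≤ ℓ₂ →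
          ∀ (η : LGConfig 4 G) (x y : Fin 4 → ℤ), (n₀ : ℝ) ≤ ‖siteToE (y - x)‖ →
            K (‖siteToE (y - x)‖ * a β) * ‖siteToE (y - x)‖ ≤ (depth c b x : ℝ) →
            K (‖siteToE (y - x)‖ * a β) * ‖siteToE (y - x)‖ ≤ (depth c b y : ℝ) →
              ‖siteToE (y - x)‖ ^ 8 * |kerCov G r β c b η (dens G r x) (dens G r y)| ≤
                C₂ / Real.log (1 / (‖siteToE (y - x)‖ * a β)) ^ 2


/-! ## Line «pointwise-log-ceiling-r» v5 (lead ym-line-frs-p1 g5, 2026-08-28): the AF debt at the CENTRE of CENTRED cubes only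

By the law of total covariance through the centred sub-cube of radius `depth x − 1` and the frozen-boundary law `FBL` (the
shared engine stub), the femto log two-point law only needs the pairs `(0, y)` of the centred cubes `[-N, N]⁴`
(`CentredLog.femtoLog_of_centred` / `femtoLogSigR_of_centred`, `Theorems/ForcedResponseSkewnessRunningCouplingCeilingFemtoLogOfCentred.lean`;
the remainder `4C₁²/((K'‖y−x‖)⁴((K'−1)‖y−x‖)⁴)` is absorbed by enlarging the collar depth to `2K + 2 + max 0 log(1/s)` and the constant
to `C₂ + 4C₁²`).  Same one-loop model audit as `FemtoLogSigR` (frs-p3 06:37Z); engine: Bałaban small-field RG in ONE femto cube with an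
arbitrary exterior, two-point function of the action density to log² precision — not in print.  Nothing here is asserted. -/

/-- **Statement of `stub_centredFemtoLog` of line «pointwise-log-ceiling-r» v5** (ASYMPTOTIC-FREEDOM class, femto currency, ENGINE
FORM of the crux's debt): along a unit pinned by a compactly supported positive-time clause-(i) floor witness, the femto log
two-point law AT THE CENTRE of the centred femto cubes `[-N, N]⁴` (`(2N+1)·a(β) ≤ ℓ₂`): for EVERY exterior and every `y` with
`n₀ ≤ ‖y‖` and `(K(‖y‖·a(β)) + 1)·‖y‖ ≤ N+1` (both ends at collar depth `≥ K·‖y‖`),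
`‖y‖⁸ |kerCov_η(dens 0, dens y)| ≤ C₂ / log²(1/(‖y‖·a(β)))`, with `K ≥ 1` and `s·K(s) → 0` as `s → 0⁺`. -/
def CentredFemtoLogSigR : Prop :=
  ∀ (G : Type) [Group G] [TopologicalSpace G] [IsTopologicalGroup G] [CompactSpace G],
    IsCompactSimpleLieGroup G →
    letI : MeasurableSpace G := borel G
    haveI : BorelSpace G := ⟨rfl⟩
    ∀ (r : LatticeRep G) (a : ℝ → ℝ), (∀ β, 0 < a β) → Filter.Tendsto a Filter.atTop (nhds 0) →
      (∃ (v₀ : 𝓢(EuclideanSpace ℝ (Fin 4), ℝ)) (ε β₅ Λ₅ : ℝ), HasCompactSupport v₀ ∧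
        tsupport v₀ ⊆ {y : EuclideanSpace ℝ (Fin 4) | 0 < y 0} ∧ 0 < ε ∧
        ∀ β : ℝ, β₅ ≤ β → ∀ L : ℕ, Λ₅ ≤ a β * L → ε ≤ Q2 G r β L (a β) (thetaTest 4 v₀) v₀) →
      ∃ (ℓ₂ C₂ β₂ : ℝ) (K : ℝ → ℝ) (n₀ : ℕ), 0 < ℓ₂ ∧ (∀ s, 1 ≤ K s) ∧
        Filter.Tendsto (fun s : ℝ => s * K s) (nhdsWithin 0 (Set.Ioi 0)) (nhds 0) ∧
        ∀ β : ℝ, β₂ ≤ β → ∀ N : ℕ, ((2 * N + 1 : ℕ) : ℝ) * a β ≤ ℓ₂ →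
          ∀ (η : LGConfig 4 G) (y : Fin 4 → ℤ), (n₀ : ℝ) ≤ ‖siteToE y‖ →
            (K (‖siteToE y‖ * a β) + 1) * ‖siteToE y‖ ≤ (N : ℝ) + 1 →
              ‖siteToE y‖ ^ 8 * |kerCov G r β (fun _ => -(N : ℤ)) (2 * N + 1) η (dens G r 0) (dens G r y)| ≤
                C₂ / Real.log (1 / (‖siteToE y‖ * a β)) ^ 2

end Summit.QuantumFields.YangMills.Cruxes.RunningCouplingCeiling.Pointwise

end
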